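import Literature.FieldTheory.FunctionField.RationalAffineFixingGroup
import Mathlib.RingTheory.IntegralDomain
import HarnessLib

/-!
# All maximal chains of subgroups of `AGL(1,p)` have the same length, hence for `q = p` prime ALL complete
# decompositions of `P_p = (x^p − x)^{p−1}` have length `Ω(p−1) + 1`; Corollary 25: `P_q` has complete decompositions
# of different lengths iff `q` is not prime (Gutierrez–Sevilla 2006, Thm 24, Cor. 25)

Topic `Literature/FieldTheory/FunctionField`; namespace `Literature.FieldTheory.FunctionField`.  Lane
`lit-hodgefound` (Track 2 foundations library), seat p01 gen 28, row g28-#12 — second half of the Thm 24 programme,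
sequel BY IMPORT of g28-#11 `RationalAffineFixingGroup` (`G(P_q) = {u ↦ au + b}`, `|G(P_q)| = q(q−1)`,
`Fix(G(P_q)) = K(P_q)`, `algebraMap_affine_eq_iff`), g28-#6 (`gutierrezSevilla_saturatedChains_exact`,
`mem_rootSet_X_pow_sub_X_iff`, `ratFunc_algEquiv_apply_algebraMap`), g26-#3 (Galois correspondence
`fixedField_fixingSubgroup_of_le`, `fixingSubgroup_fixedField_of_le`, `algEquiv_ext_of_apply_X_eq`) and Mathlib
(`isCyclic_subgroup_units`: finite subgroups of `Kˣ` are cyclic; `card_nthRoots`; `Subgroup.index_ker`,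
`Subgroup.relIndex_sup_right`, `Subgroup.eq_bot_or_eq_top_of_prime_card`, `ArithmeticFunction.cardFactors_mul`).
THEOREMS ONLY (no definition, no named fact, no instance, no notation; D-0014/D-0026, net Literature debt 0).

## Source, VERBATIM (J. Gutierrez, D. Sevilla [GutierrezSevilla2006], held `paper:arxiv-0803.3976`, p0006–p0007)

«As there is a bijection between the subgroups of `Γ₀` and the components of `(x^q − x)^{q−1}` on the right, we
will study those subgroups in order to determine whether this polynomial has complete decompositions of different
length when `q` is prime. Definition 22. `H₀ = {x + b : b ∈ 𝔽_q}`. Lemma 23. `Γ₀` is the semidirect product of `H₀`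
and `{ax : a ∈ 𝔽_q^*}`. Let `G` be a subgroup of `Γ₀`. As `H₀` has prime order, we have two cases:
• `G ∩ H₀ = H₀`. Then `H₀ ⊆ G`. […] `G₀ = {a ∈ 𝔽_q^* : ax ∈ G} < 𝔽_q^*`. But `𝔽_q^*` is cyclic of order `q − 1`, thus
`G₀` is cyclic of order `m | q − 1`. In this case, `G = H₀ ⋊ G₀ ≅ C_q ⋊ C_m`.
• `G ∩ H₀ = {x}`. Then for every `a ∈ G₀` there exists exactly one `b ∈ 𝔽_q` such that `ax + b ∈ G` […] As `G₀` is
cyclic, we have that `G` is generated by some `a₀x + b₀` […].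
Theorem 24. If `q` is prime, then all the maximal chains of subgroups of `Γ₀(𝔽_q)` have the same length.
Proof. Let `G₀ = {x} < G₁ < … < G_n = Γ₀(𝔽_q)` be a maximal chain. Let `i` be such that `G_{i−1} ∩ H₀ = {x}` and
for all `j ≥ i`, `H₀ ⊆ G_j`. For each `j ≥ i` there exists a cyclic group `C_i` of order `m_i` with `m_i | q − 1` such
that `G_i = H₀ ⋊ C_i`. Thus, the numbers `m_i, m_{i+1}, …, m_n` are a maximal chain of divisors of `q − 1` greater or
equal than `m_i`. On the other hand, `G_{i−1}` must be a cyclic group of order `m_i`, therefore the orders of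
`G_1, …, G_{i−1}` are a maximal chain of divisors of `m_i`. Therefore, the length of the chain `G₀, …, G_n` is equal to
the number of prime factors in a complete factorization of `q − 1` plus two. □
Corollary 25. The polynomial `(x^q − x)^{q−1} ∈ 𝔽_q[x]` has maximal decomposition chains of different lengths iff
`q` is not prime.»

## What is formalised (`K` a field; from §3 on `char K = p` prime; «length» of a chain `E₀ ⋖ ⋯ ⋖ E_k` = `k` = the
## number of indecomposable components, so GS's «number of prime factors of `q − 1` plus two» groups = `Ω(p−1)+1` steps)

* §1 THE CYCLIC COVERING LEMMA: `finite_units_pow_eq_one` (at most `n` units with `x^n = 1`),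
  **`exists_prime_card_eq_mul_of_covBy_units`** (for finite subgroups `A₂ < A₁ ≤ Kˣ` with no subgroup strictly
  between, `|A₁| = ℓ·|A₂|`, `ℓ` prime — `A₁` is cyclic and a composite index `e₁e₂` would put the
  `|A₂|e₁`-torsion strictly in between).
* §2 THE AFFINE COUNT: `card_eq_card_ker_subgroupOf_mul_card_map` (`|H| = |H ∩ ker| · |f(H)|`),
  `map_comap_inf_eq_of_le`, **`exists_prime_card_eq_mul_of_covBy_of_ker`** — for a homomorphism `f : G → Kˣ` from a
  finite group whose kernel has prime order `p`, every covering `H₂ ⋖ H₁` among the subgroups of `G` has prime index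
  (GS's two cases «`G ∩ H₀ = H₀`» / «`G ∩ H₀ = {x}`» and the passage between them).
* §3 (`char K = p`): `algEquiv_mul_apply_X_affine` (composition of affine substitutions),
  `ncard_rootSet_X_pow_char_sub_X` (`x^p − x` has the `p` roots `0, …, p−1` in `K`),
  **`exists_monoidHom_fixingSubgroup_P`** (the character `σ_{a,b} ↦ a` on `G(P_p) = Γ₀` with kernel `H₀` of order
  `p` — Lemma 23), **`P_prime_chain_length`** — THEOREM 24 IN THE LÜROTH LATTICE: every complete decomposition of
  `P_p` over any field of characteristic `p` has length `Ω(p−1) + 1`, and **`gutierrezSevilla_corollary_25`** —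
  COROLLARY 25 as an iff (for `q = p^m`, `𝔽_q ⊆ K`: complete decompositions of different lengths exist iff `m ≥ 2`).

## Honest deviations

GS argue inside `Γ₀(𝔽_q) ≅ 𝔽_q ⋊ 𝔽_q^*`; here the group is `G(P_p) ≤ Aut_K K(u)` (identified with `Γ₀` in g28-#11),
the semidirect-product description is replaced by the character `σ ↦ a` with kernel of order `p`, and «maximal
chains of subgroups have the same length» is proved in the sharper local form «every covering step has prime index»
(so the common length is `Ω(|Γ₀|) = Ω(p(p−1))`).  `q` prime only (as in Thm 24); `K` any field of characteristic `p`.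

## References
* [GutierrezSevilla2006] J. Gutierrez, D. Sevilla, *On Ritt's decomposition theorem in the case of finite fields*,
  Finite Fields Appl. 12 (2006) 403–412, §3 Definition 22, Lemma 23, Theorem 24, Corollary 25.
-/

open Polynomial IntermediateField

namespace Literature.FieldTheory.FunctionField

variable {K : Type*} [Field K]


/-! ### §1. The cyclic covering lemma for finite subgroups of `Kˣ` -/

/-- In `Kˣ` the solutions of `x^n = 1` (`n ≥ 1`) form a finite set with at most `n` elements.
[cite: GutierrezSevilla2006, §3 Lemma 23 («F_q^* is cyclic of order q − 1»)] -/
theorem finite_units_pow_eq_one {n : ℕ} (hn : 0 < n) :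
    ({x : Kˣ | x ^ n = 1} : Set Kˣ).Finite ∧ ({x : Kˣ | x ^ n = 1} : Set Kˣ).ncard ≤ n := by
  classical
  have hsub : ({x : K | x ^ n = 1} : Set K) ⊆ ↑(nthRoots n (1 : K)).toFinset := by
    intro x hx
    rw [Finset.mem_coe, Multiset.mem_toFinset]
    exact (mem_nthRoots hn).mpr hx
  have hfinK : ({x : K | x ^ n = 1} : Set K).Finite := (Finset.finite_toSet _).subset hsub
  have hpre : ({x : Kˣ | x ^ n = 1} : Set Kˣ) = (fun x : Kˣ => (x : K)) ⁻¹' {x : K | x ^ n = 1} := by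
    ext x
    simp only [Set.mem_setOf_eq, Set.mem_preimage]
    rw [← Units.val_pow_eq_pow_val, Units.val_eq_one]
  have hfin : ({x : Kˣ | x ^ n = 1} : Set Kˣ).Finite := by
    rw [hpre]
    exact hfinK.preimage Units.val_injective.injOn
  refine ⟨hfin, ?_⟩
  calc ({x : Kˣ | x ^ n = 1} : Set Kˣ).ncard
      = ((fun x : Kˣ => (x : K)) '' {x : Kˣ | x ^ n = 1}).ncard :=
        (Set.ncard_image_of_injective _ Units.val_injective).symm
    _ ≤ ({x : K | x ^ n = 1} : Set K).ncard := by
        apply Set.ncard_le_ncard _ hfinK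
        rw [hpre]
        exact Set.image_preimage_subset _ _
    _ ≤ (↑(nthRoots n (1 : K)).toFinset : Set K).ncard := Set.ncard_le_ncard hsub (Finset.finite_toSet _)
    _ = (nthRoots n (1 : K)).toFinset.card := Set.ncard_coe_finset _
    _ ≤ Multiset.card (nthRoots n (1 : K)) := Multiset.toFinset_card_le _
    _ ≤ n := card_nthRoots n 1

/-- **Covering steps among finite subgroups of `Kˣ` have prime index**: if `A₂ < A₁ ≤ Kˣ`, `A₁` finite, with no
subgroup strictly between them, then `|A₁| = ℓ·|A₂|` for a prime `ℓ` (`A₁` is cyclic; for a composite index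
`e = e₁e₂` the `|A₂|e₁`-torsion of `A₁` would lie strictly between) — «a maximal chain of divisors of q − 1».
[cite: GutierrezSevilla2006, §3 Thm 24 (proof: «m_i, …, m_n are a maximal chain of divisors of q − 1»)] -/
theorem exists_prime_card_eq_mul_of_covBy_units {A₁ A₂ : Subgroup Kˣ} [Finite A₁] (hlt : A₂ < A₁)
    (hcov : ∀ S : Subgroup Kˣ, A₂ ≤ S → S ≤ A₁ → S = A₂ ∨ S = A₁) :
    ∃ ℓ : ℕ, ℓ.Prime ∧ Nat.card A₁ = ℓ * Nat.card A₂ := by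
  classical
  haveI : Finite A₂ := Finite.of_injective _ (Subgroup.inclusion_injective hlt.le)
  obtain ⟨e, he⟩ := Subgroup.card_dvd_of_le hlt.le
  set d := Nat.card A₂ with hd
  have hd0 : 0 < d := Nat.card_pos
  have hn : Nat.card A₁ = d * e := he
  have he1 : e ≠ 1 := by
    intro h1
    rw [h1, mul_one] at hn
    exact hlt.ne (Subgroup.eq_of_le_of_card_ge hlt.le (by rw [hn]))
  have he0 : e ≠ 0 := by
    intro h0
    rw [h0, mul_zero] at hn
    exact Nat.card_pos.ne' hn
  refine ⟨e, ?_, by rw [hn, mul_comm]⟩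
  by_contra hne
  obtain ⟨e₁, he₁e, he₁2, he₁lt⟩ := Nat.exists_dvd_of_not_prime2 (by omega) hne
  obtain ⟨e₂, rfl⟩ := he₁e
  have he₂ : 2 ≤ e₂ := by
    by_contra h
    have : e₂ = 0 ∨ e₂ = 1 := by omega
    rcases this with h0 | h1
    · rw [h0, mul_zero] at he0; exact he0 rfl
    · rw [h1, mul_one] at he₁lt; exact lt_irrefl _ he₁lt
  -- the `(d e₁)`-torsion `S` of `A₁`
  let S : Subgroup Kˣ :=
    { carrier := {x | x ∈ A₁ ∧ x ^ (d * e₁) = 1}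
      one_mem' := ⟨A₁.one_mem, one_pow _⟩
      mul_mem' := by
        rintro x y ⟨hx, hx1⟩ ⟨hy, hy1⟩
        exact ⟨A₁.mul_mem hx hy, by rw [mul_pow, hx1, hy1, one_mul]⟩
      inv_mem' := by
        rintro x ⟨hx, hx1⟩
        exact ⟨A₁.inv_mem hx, by rw [inv_pow, hx1, inv_one]⟩ }
  have hSmem : ∀ x, x ∈ S ↔ x ∈ A₁ ∧ x ^ (d * e₁) = 1 := fun x => Iff.rfl
  have hS₁ : S ≤ A₁ := fun x hx => ((hSmem x).mp hx).1
  have hS₂ : A₂ ≤ S := by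
    intro x hx
    refine (hSmem x).mpr ⟨hlt.le hx, ?_⟩
    have h : (⟨x, hx⟩ : A₂) ^ Nat.card A₂ = 1 := pow_card_eq_one'
    have h' : x ^ d = 1 := by
      have h2 := congrArg Subtype.val h
      rw [Subgroup.coe_pow, Subgroup.coe_one] at h2
      exact h2
    rw [pow_mul, h', one_pow]
  haveI : Finite S := Finite.of_injective _ (Subgroup.inclusion_injective hS₁)
  -- lower bound: the powers of `g ^ e₂`, `g` a generator of `A₁`, lie in `S`
  obtain ⟨g, hg⟩ := IsCyclic.exists_generator (α := A₁)
  have hog : orderOf g = d * (e₁ * e₂) := by rw [orderOf_eq_card_of_forall_mem_zpowers hg, hn]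
  have hog' : orderOf (g ^ e₂) = d * e₁ := by
    rw [orderOf_pow_of_dvd (by omega) (by rw [hog]; exact Dvd.intro_left (d * e₁) (by ring)), hog,
      show d * (e₁ * e₂) = d * e₁ * e₂ by ring, Nat.mul_div_cancel _ (by omega)]
  have hzmem : ∀ x : A₁, x ∈ Subgroup.zpowers (g ^ e₂) → (x : Kˣ) ∈ S := by
    intro x hx
    obtain ⟨k, rfl⟩ := Subgroup.mem_zpowers_iff.mp hx
    refine (hSmem _).mpr ⟨((g ^ e₂) ^ k).2, ?_⟩
    have h : ((g ^ e₂) ^ k) ^ (d * e₁) = (1 : A₁) := by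
      rw [← zpow_natCast, ← zpow_mul, mul_comm, zpow_mul, zpow_natCast, ← hog', pow_orderOf_eq_one, one_zpow]
    have := congrArg Subtype.val h
    simpa using this
  have hcardS : d * e₁ ≤ Nat.card S := by
    let f : Subgroup.zpowers (g ^ e₂) → S := fun x => ⟨x.1.val, hzmem x.1 x.2⟩
    have hf : Function.Injective f := by
      intro x y h
      have h' := congrArg (fun z : S => (z : Kˣ)) h
      exact Subtype.ext (Subtype.ext h')
    have h := Nat.card_le_card_of_injective f hf
    rwa [Nat.card_zpowers, hog'] at h
  -- upper bound: at most `d e₁` units with `x^{d e₁} = 1`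
  have hcardS' : Nat.card S ≤ d * e₁ := by
    obtain ⟨hfin, hle⟩ := finite_units_pow_eq_one (K := K) (n := d * e₁) (by positivity)
    calc Nat.card S = (S : Set Kˣ).ncard := Nat.card_coe_set_eq (S : Set Kˣ)
      _ ≤ ({x : Kˣ | x ^ (d * e₁) = 1} : Set Kˣ).ncard := Set.ncard_le_ncard (fun x hx => ((hSmem x).mp hx).2) hfin
      _ ≤ d * e₁ := hle
  rcases hcov S hS₂ hS₁ with h | h
  · have : Nat.card S = d := by rw [h]
    rw [this] at hcardS
    have : d * 2 ≤ d * e₁ := Nat.mul_le_mul_left d he₁2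
    omega
  · have : Nat.card S = d * (e₁ * e₂) := by rw [h, hn]
    rw [this] at hcardS'
    have : d * e₁ * 2 ≤ d * e₁ * e₂ := Nat.mul_le_mul_left _ he₂
    nlinarith

/-! ### §2. The affine count: coverings in a group with a character whose kernel has prime order -/

/-- For `f : G → Kˣ` and `H ≤ G`: `|H| = |ker f ∩ H| · |f(H)|`. [cite: GutierrezSevilla2006, §3 Lemma 23, Thm 24 (proof: G = H₀ ⋊ G₀)] -/
theorem card_eq_card_ker_subgroupOf_mul_card_map {Gr : Type*} [Group Gr] [Finite Gr] (f : Gr →* Kˣ)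
    (H : Subgroup Gr) : Nat.card H = Nat.card (f.ker.subgroupOf H) * Nat.card (H.map f) := by
  have h1 := Subgroup.index_ker (f.restrict H)
  rw [MonoidHom.ker_restrict, MonoidHom.restrict_range] at h1
  have h2 := Subgroup.card_mul_index ((f.ker).subgroupOf H)
  rw [h1] at h2
  exact h2.symm

/-- `f(f⁻¹(S) ∩ H) = S` when `S ≤ f(H)`. [cite: GutierrezSevilla2006, §3 Thm 24 (proof)] -/
theorem map_comap_inf_eq_of_le {Gr : Type*} [Group Gr] (f : Gr →* Kˣ) {H : Subgroup Gr} {S : Subgroup Kˣ}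
    (hS : S ≤ H.map f) : (S.comap f ⊓ H).map f = S := by
  ext x
  constructor
  · rintro ⟨y, ⟨hyS, -⟩, rfl⟩
    exact hyS
  · intro hx
    obtain ⟨y, hyH, rfl⟩ := hS hx
    exact ⟨y, ⟨hx, hyH⟩, rfl⟩

/-- **The covering count for `AGL(1,p)`-like groups**: let `f : G → Kˣ` be a homomorphism from a finite group whose
kernel has prime order `p`. If `H₂ < H₁ ≤ G` with no subgroup strictly between, then `|H₁| = ℓ·|H₂|` for a prime `ℓ`
(`ℓ = p` when `H₁ ⊇ ker f ⊄ H₂` — the passage from «`G ∩ H₀ = {x}`» to «`H₀ ⊆ G`»; otherwise `ℓ = [f(H₁) : f(H₂)]`,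
prime by the cyclic covering lemma). [cite: GutierrezSevilla2006, §3 Lemma 23, Thm 24 (proof, both cases)] -/
theorem exists_prime_card_eq_mul_of_covBy_of_ker {Gr : Type*} [Group Gr] [Finite Gr] (f : Gr →* Kˣ)
    {p : ℕ} (hp : p.Prime) (hker : Nat.card f.ker = p) {H₁ H₂ : Subgroup Gr} (hlt : H₂ < H₁)
    (hcov : ∀ S : Subgroup Gr, H₂ ≤ S → S ≤ H₁ → S = H₂ ∨ S = H₁) :
    ∃ ℓ : ℕ, ℓ.Prime ∧ Nat.card H₁ = ℓ * Nat.card H₂ := by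
  classical
  haveI : Fact (Nat.card f.ker).Prime := ⟨by rw [hker]; exact hp⟩
  -- dichotomy: `ker ≤ H` or `ker ⊓ H = ⊥`
  have hdich : ∀ H : Subgroup Gr, f.ker ≤ H ∨ f.ker.subgroupOf H = ⊥ := by
    intro H
    rcases (H.subgroupOf f.ker).eq_bot_or_eq_top_of_prime_card with h | h
    · right
      rw [Subgroup.subgroupOf_eq_bot] at h ⊢
      exact h.symm
    · left
      exact Subgroup.subgroupOf_eq_top.mp h
  have hcardH := fun H : Subgroup Gr => card_eq_card_ker_subgroupOf_mul_card_map f H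
  have hkerH : ∀ H : Subgroup Gr, f.ker ≤ H → Nat.card (f.ker.subgroupOf H) = p := fun H h => by
    rw [Nat.card_congr (Subgroup.subgroupOfEquivOfLe h).toEquiv, hker]
  -- the transfer to the images `A_i = f(H_i) ≤ Kˣ`
  set A₁ := H₁.map f with hA₁
  set A₂ := H₂.map f with hA₂
  haveI : Finite A₁ := Finite.of_surjective (fun x : H₁ => (⟨f x, x, x.2, rfl⟩ : A₁))
    (by rintro ⟨y, x, hx, rfl⟩; exact ⟨⟨x, hx⟩, rfl⟩)
  have hA : A₂ ≤ A₁ := Subgroup.map_mono hlt.le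
  have hAcov : ∀ S : Subgroup Kˣ, A₂ ≤ S → S ≤ A₁ → S = A₂ ∨ S = A₁ := by
    intro S hS₂ hS₁
    have h2 : H₂ ≤ S.comap f ⊓ H₁ := le_inf (fun x hx => hS₂ ⟨x, hx, rfl⟩) hlt.le
    rcases hcov (S.comap f ⊓ H₁) h2 inf_le_right with h | h
    · left
      rw [← map_comap_inf_eq_of_le f hS₁, h]
    · right
      rw [← map_comap_inf_eq_of_le f hS₁, h]
  have key : ∀ c : ℕ, 0 < c → Nat.card H₁ = c * Nat.card A₁ → Nat.card H₂ = c * Nat.card A₂ →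
      ∃ ℓ : ℕ, ℓ.Prime ∧ Nat.card H₁ = ℓ * Nat.card H₂ := by
    intro c hc hc₁ hc₂
    have hAlt : A₂ < A₁ := by
      refine lt_of_le_of_ne hA fun heq => hlt.ne ?_
      exact Subgroup.eq_of_le_of_card_ge hlt.le (by rw [hc₁, hc₂, heq])
    obtain ⟨ℓ, hℓ, hℓc⟩ := exists_prime_card_eq_mul_of_covBy_units hAlt hAcov
    exact ⟨ℓ, hℓ, by rw [hc₁, hc₂, hℓc]; ring⟩
  by_cases h₂ : f.ker ≤ H₂
  · -- case (a): both contain the kernel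
    have h₁ : f.ker ≤ H₁ := h₂.trans hlt.le
    exact key p hp.pos (by rw [hcardH H₁, hkerH H₁ h₁]) (by rw [hcardH H₂, hkerH H₂ h₂])
  · by_cases h₁ : f.ker ≤ H₁
    · -- case (b): `ker ≤ H₁`, `ker ⊄ H₂`: index `p`
      refine ⟨p, hp, ?_⟩
      have hb₂ : f.ker.subgroupOf H₂ = ⊥ := (hdich H₂).resolve_left h₂
      have hsup : H₂ ⊔ f.ker = H₁ := by
        rcases hcov (H₂ ⊔ f.ker) le_sup_left (sup_le hlt.le h₁) with h | h
        · exact absurd (le_sup_right.trans h.le) h₂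
        · exact h
      have hr := Subgroup.relIndex_sup_right H₂ f.ker
      rw [hsup] at hr
      have hi₁ : Nat.card (f.ker.subgroupOf H₁) * (f.ker.subgroupOf H₁).index = Nat.card H₁ :=
        Subgroup.card_mul_index _
      rw [hkerH H₁ h₁] at hi₁
      have hi₂ : f.ker.relIndex H₂ = Nat.card H₂ := by
        rw [Subgroup.relIndex, hb₂, Subgroup.index_bot]
      rw [Subgroup.relIndex] at hi₂
      change (f.ker.subgroupOf H₁).index = (f.ker.subgroupOf H₂).index at hr
      rw [← hi₁, hr, hi₂]
    · -- case (c): both meet the kernel trivially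
      have hc₁ : f.ker.subgroupOf H₁ = ⊥ := (hdich H₁).resolve_left h₁
      have hc₂ : f.ker.subgroupOf H₂ = ⊥ := (hdich H₂).resolve_left h₂
      exact key 1 one_pos (by rw [hcardH H₁, hc₁, Subgroup.card_bot]) (by rw [hcardH H₂, hc₂, Subgroup.card_bot])



/-! ### §3. Theorem 24 and Corollary 25 -/

/-- Composition of affine substitutions: `(σ_{a,b} σ_{a',b'})(u) = a'a·u + (a'b + b')`.
[cite: GutierrezSevilla2006, §3 Lemma 23 (Γ₀ = H₀ ⋊ {ax})] -/
theorem algEquiv_mul_apply_X_affine {σ τ : RatFunc K ≃ₐ[K] RatFunc K} {a b a' b' : K}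
    (hσ : σ RatFunc.X = algebraMap K[X] (RatFunc K) (C a * X + C b))
    (hτ : τ RatFunc.X = algebraMap K[X] (RatFunc K) (C a' * X + C b')) :
    (σ * τ) RatFunc.X = algebraMap K[X] (RatFunc K) (C (a' * a) * X + C (a' * b + b')) := by
  rw [AlgEquiv.mul_apply, hτ, ratFunc_algEquiv_apply_algebraMap, hσ, ← algebraMap_comp_eq_aeval]
  congr 1
  simp only [add_comp, mul_comp, C_comp, X_comp, map_mul, map_add]
  ring

section PrimeField

variable (p : ℕ) [hp : Fact p.Prime] [CharP K p]

/-- Over a field of characteristic `p`, `x^p − x` has exactly the `p` roots `0, 1, …, p − 1` (so `𝔽_p ⊆ K` needs no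
hypothesis). [cite: GutierrezSevilla2006, §3 Def. 22 (H₀ = {x + b : b ∈ F_q})] -/
theorem ncard_rootSet_X_pow_char_sub_X : (((X : K[X]) ^ p - X).rootSet K).ncard = p := by
  classical
  have hp1 : 1 < p := hp.out.one_lt
  have hne : ((X : K[X]) ^ p - X) ≠ 0 := FiniteField.X_pow_card_sub_X_ne_zero K hp1
  apply le_antisymm
  · rw [rootSet_def, aroots_def, Algebra.algebraMap_self, Polynomial.map_id, Set.ncard_coe_finset]
    exact (Multiset.toFinset_card_le _).trans
      ((card_roots' _).trans (FiniteField.X_pow_card_sub_X_natDegree_eq K hp1).le)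
  · have hsub : ((Finset.range p).image (fun k : ℕ => (k : K)) : Set K) ⊆ ((X : K[X]) ^ p - X).rootSet K := by
      intro w hw
      rw [Finset.coe_image, Set.mem_image] at hw
      obtain ⟨k, -, rfl⟩ := hw
      rw [Polynomial.mem_rootSet_of_ne hne, map_sub, map_pow, aeval_X, ← frobenius_def, map_natCast, sub_self]
    have h := Set.ncard_le_ncard hsub (((X : K[X]) ^ p - X).rootSet_finite K)
    rwa [Set.ncard_coe_finset, Finset.card_image_of_injOn, Finset.card_range] at h
    intro k hk k' hk' hkk'
    have h' : (k : K) = (k' : K) := hkk'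
    rw [CharP.natCast_eq_natCast (R := K) (p := p)] at h'
    exact Nat.ModEq.eq_of_lt_of_lt h' (Finset.mem_range.mp hk) (Finset.mem_range.mp hk')

/-- **The character `σ_{a,b} ↦ a` on `G(P_p) = Γ₀ = AGL(1, 𝔽_p)`**: a homomorphism `G(P_p) → Kˣ` reading off the
multiplier `a`, whose kernel — the translations `H₀ = {u ↦ u + b : b ∈ 𝔽_p}` — has order `p` (`|ker| ≤ p` and
`|image| ≤ p − 1` by injecting into the roots of `x^p − x`, and `|ker|·|image| = |G(P_p)| = p(p−1)`).
[cite: GutierrezSevilla2006, §3 Def. 22, Lemma 23] -/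
theorem exists_monoidHom_fixingSubgroup_P :
    ∃ φ : (IntermediateField.adjoin K
        ({algebraMap K[X] (RatFunc K) (((X : K[X]) ^ p - X) ^ (p - 1))} : Set (RatFunc K))).fixingSubgroup →* Kˣ,
      (∀ σ : (IntermediateField.adjoin K
        ({algebraMap K[X] (RatFunc K) (((X : K[X]) ^ p - X) ^ (p - 1))} : Set (RatFunc K))).fixingSubgroup,
        ∃ b : K, σ.1 RatFunc.X = algebraMap K[X] (RatFunc K) (C ((φ σ : Kˣ) : K) * X + C b)) ∧
      Nat.card φ.ker = p := by
  classical
  have hroots : (((X : K[X]) ^ p ^ 1 - X).rootSet K).ncard = p ^ 1 := by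
    rw [pow_one]; exact ncard_rootSet_X_pow_char_sub_X p
  obtain ⟨hcard, haff⟩ := card_fixingSubgroup_adjoin_P (K := K) p (m := 1) le_rfl hroots
  simp only [pow_one] at hcard haff
  set G := (IntermediateField.adjoin K
        ({algebraMap K[X] (RatFunc K) (((X : K[X]) ^ p - X) ^ (p - 1))} : Set (RatFunc K))).fixingSubgroup with hG
  choose a b ha ha0 hb hσ using haff
  -- the character
  let φ : G →* Kˣ :=
    { toFun := fun σ => Units.mk0 (a σ σ.2) (ha0 σ σ.2)
      map_one' := by
        apply Units.ext
        rw [Units.val_mk0, Units.val_one]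
        have h := hσ (1 : G) (1 : G).2
        have h1 : ((1 : G) : RatFunc K ≃ₐ[K] RatFunc K) RatFunc.X = algebraMap K[X] (RatFunc K) (C 1 * X + C 0) := by
          rw [map_one, one_mul, map_zero, add_zero, RatFunc.algebraMap_X]; rfl
        rw [h1, algebraMap_affine_eq_iff] at h
        exact h.1.symm
      map_mul' := by
        intro σ τ
        apply Units.ext
        rw [Units.val_mul, Units.val_mk0, Units.val_mk0, Units.val_mk0]
        have h := hσ (σ * τ) (σ * τ).2
        have h2 := algEquiv_mul_apply_X_affine (hσ σ σ.2) (hσ τ τ.2)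
        rw [h2, algebraMap_affine_eq_iff] at h
        exact h.1.symm.trans (mul_comm _ _) }
  have hφ : ∀ σ : G, ((φ σ : Kˣ) : K) = a σ σ.2 := fun σ => rfl
  refine ⟨φ, fun σ => ⟨b σ σ.2, by rw [hφ]; exact hσ σ σ.2⟩, ?_⟩
  -- `|ker φ| ≤ p`: the kernel injects into the roots of `x^p − x` via `σ ↦ b(σ)`
  haveI : Finite G := by
    rw [hG]
    exact finite_fixingSubgroup_adjoin (algebraMap_ne_C_of_natDegree_ne_zero (by
      rw [natDegree_pow, FiniteField.X_pow_card_sub_X_natDegree_eq K hp.out.one_lt]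
      exact Nat.mul_ne_zero (by have := hp.out.two_le; omega) hp.out.ne_zero))
  haveI : Finite (((X : K[X]) ^ p - X).rootSet K) := (((X : K[X]) ^ p - X).rootSet_finite K).to_subtype
  have hmemR : ∀ w : K, w ^ p = w → w ∈ ((X : K[X]) ^ p - X).rootSet K := fun w hw => by
    have h := (mem_rootSet_X_pow_sub_X_iff (K := K) p (m := 1) le_rfl (w := w)).mpr (by rw [pow_one]; exact hw)
    simpa only [pow_one] using h
  have hker_le : Nat.card φ.ker ≤ p := by
    let g : φ.ker → ((X : K[X]) ^ p - X).rootSet K := fun σ => ⟨b σ.1 σ.1.2, hmemR _ (hb σ.1 σ.1.2)⟩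
    have hg : Function.Injective g := by
      intro σ τ h
      have hbeq : b σ.1 σ.1.2 = b τ.1 τ.1.2 := congrArg Subtype.val h
      have haσ : a σ.1 σ.1.2 = 1 := by
        have := σ.2
        rw [MonoidHom.mem_ker] at this
        have := congrArg (fun u : Kˣ => (u : K)) this
        rwa [hφ, Units.val_one] at this
      have haτ : a τ.1 τ.1.2 = 1 := by
        have := τ.2
        rw [MonoidHom.mem_ker] at this
        have := congrArg (fun u : Kˣ => (u : K)) this
        rwa [hφ, Units.val_one] at this
      have hX : (σ.1 : RatFunc K ≃ₐ[K] RatFunc K) RatFunc.X = (τ.1 : RatFunc K ≃ₐ[K] RatFunc K) RatFunc.X := by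
        rw [hσ σ.1 σ.1.2, hσ τ.1 τ.1.2, haσ, haτ, hbeq]
      exact Subtype.ext (Subtype.ext (algEquiv_ext_of_apply_X_eq hX))
    have h := Nat.card_le_card_of_injective g hg
    rwa [Nat.card_coe_set_eq, ncard_rootSet_X_pow_char_sub_X p] at h
  -- `|range φ| ≤ p − 1`: the range injects into the non-zero roots
  have hrange_le : Nat.card φ.range ≤ p - 1 := by
    haveI : Finite ((((X : K[X]) ^ p - X).rootSet K \ {0} : Set K)) :=
      ((((X : K[X]) ^ p - X).rootSet_finite K).subset Set.sdiff_subset).to_subtype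
    let g : φ.range → ((((X : K[X]) ^ p - X).rootSet K \ {0} : Set K)) := fun u => ⟨(u.1 : K), by
      obtain ⟨σ, hσu⟩ := u.2
      refine ⟨?_, ?_⟩
      · rw [← hσu, hφ]; exact hmemR _ (ha σ σ.2)
      · rw [Set.mem_singleton_iff, ← hσu, hφ]; exact ha0 σ σ.2⟩
    have hg : Function.Injective g := by
      intro u v h
      exact Subtype.ext (Units.ext (congrArg Subtype.val h))
    have h := Nat.card_le_card_of_injective g hg
    rwa [Nat.card_coe_set_eq, Set.ncard_sdiff_singleton_of_mem (hmemR 0 (zero_pow hp.out.ne_zero)),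
      ncard_rootSet_X_pow_char_sub_X p] at h
  -- `|ker| · |range| = |G| = p (p − 1)` forces `|ker| = p`
  have hprod : Nat.card φ.ker * Nat.card φ.range = p * (p - 1) := by
    rw [← Subgroup.index_ker, Subgroup.card_mul_index, hcard]
  have hk0 : 0 < Nat.card φ.ker := Nat.card_pos
  by_contra hne
  have hlt : Nat.card φ.ker < p := lt_of_le_of_ne hker_le hne
  have : Nat.card φ.ker * Nat.card φ.range < p * (p - 1) :=
    calc Nat.card φ.ker * Nat.card φ.range ≤ Nat.card φ.ker * (p - 1) := Nat.mul_le_mul_left _ hrange_le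
      _ < p * (p - 1) := Nat.mul_lt_mul_of_pos_right hlt (by have := hp.out.two_le; omega)
  omega

end PrimeField


section Thm24

variable (p : ℕ) [hp : Fact p.Prime] [CharP K p]

/-- **THEOREM 24 in the Lüroth lattice: for `q = p` prime, ALL complete decompositions of `P_p = (x^p − x)^{p−1}`
have the same length `Ω(p − 1) + 1`** — over any field of characteristic `p`, every saturated chain
`K(P_p) = E₀ ⋖ E₁ ⋖ ⋯ ⋖ E_k = K(u)` has `k = Ω(p − 1) + 1` (the fields are the fixed fields of the subgroups of
`G(P_p) = Γ₀`, g26-#3/g28-#11, and every covering step there has prime index by §2; «the length of the chain … is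
equal to the number of prime factors in a complete factorization of q − 1 plus two» counts the groups `G₀, …, G_n`).
[cite: GutierrezSevilla2006, §3 Thm 24, Cor. 25 (only if)] -/
theorem P_prime_chain_length {k : ℕ} (E : Fin (k + 1) → IntermediateField K (RatFunc K))
    (hE0 : E 0 = IntermediateField.adjoin K
      ({algebraMap K[X] (RatFunc K) (((X : K[X]) ^ p - X) ^ (p - 1))} : Set (RatFunc K)))
    (hEk : E (Fin.last k) = ⊤) (hcov : ∀ i : Fin k, E i.castSucc ⋖ E i.succ) :
    k = ArithmeticFunction.cardFactors (p - 1) + 1 := by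
  classical
  have hP := hp.out
  set P : K[X] := ((X : K[X]) ^ p - X) ^ (p - 1) with hPdef
  have hPdeg : P.natDegree = p * (p - 1) := by
    rw [hPdef, natDegree_pow, FiniteField.X_pow_card_sub_X_natDegree_eq K hP.one_lt, mul_comm]
  have hP0 : P.natDegree ≠ 0 := by
    rw [hPdeg]; exact Nat.mul_ne_zero hP.ne_zero (by have := hP.two_le; omega)
  have hPc := algebraMap_ne_C_of_natDegree_ne_zero hP0
  set G := (IntermediateField.adjoin K ({algebraMap K[X] (RatFunc K) P} : Set (RatFunc K))).fixingSubgroup with hG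
  haveI : Finite G := finite_fixingSubgroup_adjoin hPc
  have hroots : (((X : K[X]) ^ p ^ 1 - X).rootSet K).ncard = p ^ 1 := by
    rw [pow_one]; exact ncard_rootSet_X_pow_char_sub_X p
  have hGcard : Nat.card G = p * (p - 1) := by
    have h := (card_fixingSubgroup_adjoin_P (K := K) p (m := 1) le_rfl hroots).1
    simpa only [pow_one] using h
  have hFix : IntermediateField.fixedField G =
      IntermediateField.adjoin K ({algebraMap K[X] (RatFunc K) P} : Set (RatFunc K)) := by
    have h := fixedField_fixingSubgroup_adjoin_P (K := K) p (m := 1) le_rfl hroots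
    simpa only [pow_one] using h
  obtain ⟨φ, -, hker⟩ := exists_monoidHom_fixingSubgroup_P (K := K) p
  -- the subgroups `H i = G(E i) ≤ G`, `Fix(H i) = E i`
  have hle : ∀ i : Fin (k + 1), IntermediateField.fixedField G ≤ E i := by
    intro i
    refine Fin.induction (motive := fun i => IntermediateField.fixedField G ≤ E i) (by rw [hFix, hE0])
      (fun j hj => hj.trans (hcov j).le) i
  set H : Fin (k + 1) → Subgroup (RatFunc K ≃ₐ[K] RatFunc K) := fun i => (E i).fixingSubgroup with hH
  have hH1 : ∀ i, H i ≤ G ∧ IntermediateField.fixedField (H i) = E i := fun i =>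
    fixedField_fixingSubgroup_of_le G (hle i)
  -- transported into `↥G`
  set H' : Fin (k + 1) → Subgroup G := fun i => (H i).subgroupOf G with hH'
  have hH'card : ∀ i, Nat.card (H' i) = Nat.card (H i) := fun i =>
    Nat.card_congr (Subgroup.subgroupOfEquivOfLe (hH1 i).1).toEquiv
  have hH'map : ∀ i, (H' i).map G.subtype = H i := fun i => Subgroup.map_subgroupOf_eq_of_le (hH1 i).1
  -- each step has prime index
  have hstep : ∀ i : Fin k, ∃ ℓ : ℕ, ℓ.Prime ∧ Nat.card (H i.castSucc) = ℓ * Nat.card (H i.succ) := by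
    intro i
    have hc := hcov i
    have hlt : H i.succ < H i.castSucc := by
      refine lt_of_le_of_ne (IntermediateField.fixingSubgroup_antitone hc.le) ?_
      intro heq
      have h1 := (hH1 i.castSucc).2
      have h2 := (hH1 i.succ).2
      have : E i.castSucc = E i.succ := by rw [← h1, ← h2]; exact congrArg _ heq.symm
      exact hc.ne this
    have hcovH : ∀ S : Subgroup (RatFunc K ≃ₐ[K] RatFunc K), H i.succ ≤ S → S ≤ H i.castSucc →
        S = H i.succ ∨ S = H i.castSucc := by
      intro S h2 h1
      have hSG : S ≤ G := h1.trans (hH1 i.castSucc).1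
      have hFixS : (IntermediateField.fixedField S).fixingSubgroup = S := fixingSubgroup_fixedField_of_le G hSG
      have hge : E i.castSucc ≤ IntermediateField.fixedField S := by
        rw [← (hH1 i.castSucc).2]; exact IntermediateField.fixedField_antitone h1
      have hle' : IntermediateField.fixedField S ≤ E i.succ := by
        rw [← (hH1 i.succ).2]; exact IntermediateField.fixedField_antitone h2
      rcases hc.eq_or_eq hge hle' with h | h
      · right; rw [← hFixS, h]
      · left; rw [← hFixS, h]
    -- in `↥G`
    have hlt' : H' i.succ < H' i.castSucc := by
      refine lt_of_le_of_ne (Subgroup.comap_mono hlt.le) ?_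
      intro heq
      have := congrArg (Subgroup.map G.subtype) heq
      rw [hH'map, hH'map] at this
      exact hlt.ne this
    have hcov' : ∀ S : Subgroup G, H' i.succ ≤ S → S ≤ H' i.castSucc → S = H' i.succ ∨ S = H' i.castSucc := by
      intro S h2 h1
      have h2' : H i.succ ≤ S.map G.subtype := by
        rw [← hH'map i.succ]; exact Subgroup.map_mono h2
      have h1' : S.map G.subtype ≤ H i.castSucc := by
        rw [← hH'map i.castSucc]; exact Subgroup.map_mono h1
      have hback : (S.map G.subtype).subgroupOf G = S :=
        Subgroup.comap_map_eq_self_of_injective (Subgroup.subtype_injective G) S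
      rcases hcovH _ h2' h1' with h | h
      · left; rw [← hback, h]
      · right; rw [← hback, h]
    obtain ⟨ℓ, hℓ, hℓc⟩ := exists_prime_card_eq_mul_of_covBy_of_ker φ hP hker hlt' hcov'
    exact ⟨ℓ, hℓ, by rw [← hH'card, ← hH'card, hℓc]⟩
  -- count prime factors along the chain
  have hHpos : ∀ i, Nat.card (H i) ≠ 0 := by
    intro i
    haveI : Finite (H i) := Finite.of_injective _ (Subgroup.inclusion_injective (hH1 i).1)
    exact Nat.card_pos.ne'
  have htel : ∀ i : Fin (k + 1),
      ArithmeticFunction.cardFactors (Nat.card (H 0)) = ArithmeticFunction.cardFactors (Nat.card (H i)) + (i : ℕ) := by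
    intro i
    refine Fin.induction (motive := fun i : Fin (k + 1) =>
      ArithmeticFunction.cardFactors (Nat.card (H 0)) = ArithmeticFunction.cardFactors (Nat.card (H i)) + (i : ℕ))
      ?_ ?_ i
    · simp
    · intro j hj
      obtain ⟨ℓ, hℓ, hℓc⟩ := hstep j
      rw [hj, hℓc, ArithmeticFunction.cardFactors_mul hℓ.ne_zero (hHpos _),
        ArithmeticFunction.cardFactors_apply_prime hℓ, Fin.val_succ, Fin.val_castSucc]
      ring
  have h0 : Nat.card (H 0) = p * (p - 1) := by
    have e : H 0 = G := by simp only [hH, hE0, hG, hPdef]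
    rw [e, hGcard]
  have hk' : Nat.card (H (Fin.last k)) = 1 := by
    have e : H (Fin.last k) = ⊥ := by simp only [hH, hEk, IntermediateField.fixingSubgroup_top]
    rw [e, Subgroup.card_bot]
  have h := htel (Fin.last k)
  rw [h0, hk', ArithmeticFunction.cardFactors_one, zero_add, Fin.val_last,
    ArithmeticFunction.cardFactors_mul hP.ne_zero (by have := hP.two_le; omega),
    ArithmeticFunction.cardFactors_apply_prime hP] at h
  omega

/-- **COROLLARY 25, as printed: «The polynomial `(x^q − x)^{q−1} ∈ 𝔽_q[x]` has maximal decomposition chains of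
different lengths iff `q` is not prime»** — over any field of characteristic `p` containing the `q = p^m` roots of
`x^q − x`: two complete decompositions of `P_q` of different lengths exist iff `m ≥ 2` (⟸: lengths `Ω(q−1)+1` and
`Ω(q−1)+m`, g28-#6; ⟹: for `m = 1` all have length `Ω(p−1)+1`, Theorem 24). [cite: GutierrezSevilla2006, §3 Cor. 25] -/
theorem gutierrezSevilla_corollary_25 {m : ℕ} (hm : 1 ≤ m)
    (hroots : (((X : K[X]) ^ p ^ m - X).rootSet K).ncard = p ^ m) :
    (∃ (k k' : ℕ) (E : Fin (k + 1) → IntermediateField K (RatFunc K))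
        (E' : Fin (k' + 1) → IntermediateField K (RatFunc K)),
        (E 0 = IntermediateField.adjoin K
            ({algebraMap K[X] (RatFunc K) (((X : K[X]) ^ p ^ m - X) ^ (p ^ m - 1))} : Set (RatFunc K)) ∧
          E (Fin.last k) = ⊤ ∧ ∀ i : Fin k, E i.castSucc ⋖ E i.succ) ∧
        (E' 0 = IntermediateField.adjoin K
            ({algebraMap K[X] (RatFunc K) (((X : K[X]) ^ p ^ m - X) ^ (p ^ m - 1))} : Set (RatFunc K)) ∧
          E' (Fin.last k') = ⊤ ∧ ∀ i : Fin k', E' i.castSucc ⋖ E' i.succ) ∧ k ≠ k') ↔ 2 ≤ m := by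
  constructor
  · rintro ⟨k, k', E, E', ⟨hE0, hEk, hEc⟩, ⟨hE0', hEk', hEc'⟩, hkk'⟩
    by_contra hm2
    have hm1 : m = 1 := by omega
    subst hm1
    simp only [pow_one] at hE0 hE0'
    have h1 := P_prime_chain_length p E hE0 hEk hEc
    have h2 := P_prime_chain_length p E' hE0' hEk' hEc'
    exact hkk' (h1.trans h2.symm)
  · intro hm2
    obtain ⟨⟨E, hE0, hEk, hEc⟩, ⟨E', hE0', hEk', hEc'⟩⟩ := gutierrezSevilla_saturatedChains_exact (K := K) p hm2 hroots
    refine ⟨_, _, E, E', ⟨hE0, hEk, hEc⟩, ⟨hE0', hEk', hEc'⟩, ?_⟩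
    omega

end Thm24

end Literature.FieldTheory.FunctionField
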